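import Summits.HodgeConjecture.HodgeConjecture.Theses.DworkReflectionQuotients
import Literature.AlgebraicGeometry.HodgeTheory.DworkSexticReflectionAveraging

/-!
# Crux K2 `FlatClassesSpannedByReflectionInvariants` of route `DworkReflectionQuotients`,
# modulo Katz 2009 Lemma 3.1 (the named fact `Katz2009_dworkSexticEigenspaces`)

Route `route-HodgeConjecture-DworkReflectionQuotients` (cell `hodge-nonav`, rung F-H1 — never summit
credit), item `stmt-HodgeConjecture-20241`; landed `--supports stmt-HodgeConjecture-20241` (a CONDITIONAL
result: its one hypothesis is the tree's named fact `Katz2009_dworkSexticEigenspaces`, Katz 2009 Lemma 3.1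
for the Dwork sextic fourfold; the item itself stays open until that fact, or Griffiths' residue theorem
from which it follows, is discharged). Prover seat `hodge-nonav-20241-p1` (g0), 2026-08-27.

The mathematics is the Literature theorem
`Literature.AlgebraicGeometry.HodgeTheory.DworkSextic.flatClasses_mem_span_reflInvariant_of_katz`
(file `DworkSexticReflectionAveraging`, literature seat `hodge-nonav-lit` g9): for `ψ⁶ ≠ 1` and a rational
class `w = u + v` with `u`, `v` eigenclasses of `H⁴(X_ψ(ℂ); ℂ)` for one of Katz's four flat exponent
types `e ∘ σ` and its conjugate `(6 − e) ∘ σ`, the six-term averaging identity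
`6 w = Σ_{k<6} (w + g_k^* w)` over realising maps `g_k` of the reflections `s_(σ⁻¹0, σ⁻¹5, ζ₀ᵏ)`
exhibits `w` in the `ℂ`-span of rational, reflection-invariant `(2,2)`-classes — the `(2,2)`-ness of
`u + v` being Katz's Lemma 3.1(2). The body of the crux is that statement verbatim (its `let`-bound
`F`, `X`, `pt`, `IsEig`, `IsRefl` unfold to `DworkSextic.form/fibre/pt/IsEig` and the inline reflection
clause), so the proof is one `exact`.

## References

* N. M. Katz, *Another look at the Dwork family*, Progr. Math. 270 (2009), Lemma 3.1. [Katz2009]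
* G. Bini, A. Garbagnati, *Quotients of the Dwork pencil*, J. Geom. Phys. 75 (2014), §3.4.
  [BiniGarbagnati2012]
-/

namespace Summit.HodgeConjecture.HodgeConjecture.Theorems

open Literature.AlgebraicGeometry.HodgeTheory

/-- **Crux K2 modulo Katz 2009 Lemma 3.1.** Granted the named fact `Katz2009_dworkSexticEigenspaces`
(ranks and Hodge numbers of the `Γ_W/Δ`-eigenspaces of `H⁴` of the Dwork sextic fourfold), the route
statement `FlatClassesSpannedByReflectionInvariants` holds: every rational class `w = u + v` of a flat
piece `V_{e∘σ} ⊕ V_{(6−e)∘σ}` (`e` one of the four flat Katz types, `σ ∈ 𝔖₆`, `ψ⁶ ≠ 1`) lies in the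
`ℂ`-span of the rational `(2,2)`-classes fixed by a realised reflection `s_(i,i',ζ)`. One `exact` on
`DworkSextic.flatClasses_mem_span_reflInvariant_of_katz`. CONDITIONAL on the named fact (trust base:
`Katz2009_dworkSexticEigenspaces`). [cite: Katz2009, Lemma 3.1] -/
theorem flatClassesSpannedByReflectionInvariants_of_katz (hK : Katz2009_dworkSexticEigenspaces) :
    Summit.HodgeConjecture.HodgeConjecture.Theses.DworkReflectionQuotients.FlatClassesSpannedByReflectionInvariants := by
  intro ψ hψ F X pt IsEig IsRefl j σ w hw huv
  exact DworkSextic.flatClasses_mem_span_reflInvariant_of_katz hK hψ j σ w hw huv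

end Summit.HodgeConjecture.HodgeConjecture.Theorems
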